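/-
Copyright (c) 2026 the pub-hodgecm-mathlib formalisation cell (harness21).  Prover seat hodgecm-mathlib-K2E2-p12 (g2), Track B «K2-LIT», engine E2, unit CAPTURE,
socket #20a line lead, 2026-09-04.  KERNEL module: THEOREMS ONLY (no definition, no named fact, no `sorry`, no instance, no notation).
-/
import Summits.HodgeConjecture.HodgeConjecture.Theorems.F0P2tChiNGen                    -- ★ the binder currency + instance∕majorant lemmas of the (χ)+(N) row (engine side)
import Summits.HodgeConjecture.HodgeConjecture.Theorems.H413ThetaDistHolCotForms           -- ★ `funLeft_latticeEquiv_dist_mem_holCotForms_sideAt`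
import Literature.NumberTheory.Automorphic.Liu2021.ThetaLiftFromLineFrame                 -- ★ `cmAdelicFrameTransport`
import Summits.HodgeConjecture.HodgeConjecture.Theorems.K2E2CapArchKernelIdentity          -- ★ H1 (this seat): `kernelDatum_thetaLift_eq_twist_splitting_thetaLift`
import HarnessLib

set_option autoImplicit false
set_option linter.dupNamespace false

/-!
# K2 ∕ E2 «ThetaExhaustionByRigidity», unit CAPTURE, socket #20a «ARCH-PAIR-HOLCOT» — H1′-core «THE ENGINE'S HARMONIC THETA FORMS ARE LINE THETA LIFTS, AND
# THE LINE THETA PAIR OF THE PACKAGED FRAME IS A HOLOMORPHIC COTANGENT FORM of `archFactorOf F V`»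

Cell hodgecm-mathlib (D-0151), FLOOR 0, Track B «K2-LIT», engine E2, crux item H413 = stmt-HodgeConjecture-24833 (route `HCCMUnconditional`).  Socket #20a
`Capture.sig_K2E2CapArchPairHolCot`; line lead K2E2-p12 (g2); helper H1′-core.  In the binder currency of ★ `F0P2tChiNGen.chiN_gen_of_rallisAtPin`'s conclusion
(= the `hχN` hypothesis of the engine ★ `F0P2sThetaOccursInEngineGen.exists_holTheta_atFrame_of_chiN`: packaged frame `(F, V)`, `4 ≤ [F:ℚ]`, CM type `Φ`, weight-one
conjugate-symplectic `μ₀` oriented by `hmem`, admissible line `a = e·2δ`, the junction twist `ĉ` with `hĉ : chiSplitting(μ₀) = splittingOf ⊗ ĉ`, the knob rows `hν hνc`, the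
archimedean inputs `A harm hdef`), and for ANY Weil majorants `hρμ` of the `μ₀`-splitting, ANY weight `w ∈ C([U(⟨a⟩)])` and ANY finite test function `Φ_f`:
the LINE THETA PAIR `x ↦ (Θ̃^{μ₀}_{ψ_j ⊗ Φ_f}(w)(g_V,𝔸⁻¹ x g_V,𝔸))_{j=0,1}` — `ψ_j := blockFamilyOfAt … (proj j)` the engine's harmonic family, the lift taken against the push-forward of
`probHaar` along `cmLineTorusEquiv` — lies in `holCotForms (archFactorOf F V)`.  PROOF: the model's slot-0 theta form `D.dist f Φ_f ∘ latticeEquiv` is in that carrier (★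
`funLeft_latticeEquiv_dist_mem_holCotForms_sideAt` with the engine's discharges ★ `isLFAction_sideAt` ∕ `hd_of_eq` ∕ `hCR_of_eq`), and by ★ `apply_dist` + ★ H1
`kernelDatum_thetaLift_eq_twist_splitting_thetaLift` (NO `U(V)` scalar) + `hĉ` it IS the line theta pair for the weight `w` when `f := ((w·κ₂⁻¹) ∘ a)·κ₁`.
`--supports stmt-HodgeConjecture-24833 --as helper`; THEOREMS ONLY; imports ★ only.  HONEST LABEL: HC_CM is proved only modulo the 7 printed citations (2 remaining named
inputs: hLiu418 = stmt-HodgeConjecture-24832, h413 = stmt-HodgeConjecture-24833) until rung 0 closes; this file discharges no printed citation.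
References: [Liu2021] Camb. J. Math. 9 (2021) App. D §D.1 Steps 1–3, Lem. D.2 (2); [KonnoKonno2007] Kyushu J. Math. 61 (2007) Thm 5.4; [GelbartRogawski1991]
Invent. Math. 105 (1991) §3.1 Prop. 3.1.1, Remark p. 457; [Weil1964] Acta Math. 111 (1964) n° 41; [BorelJacquet1979] PSPM 33.1 §4.1–4.2.
-/

noncomputable section

open NumberField hiding relNormOneIdeles relNormOneRat probHaarRelNormOneQuot
open MulAction NumberField.InfinitePlace NumberField.mixedEmbedding IsDedekindDomain
open _root_.MeasureTheory _root_.MeasureTheory.Measure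
open scoped SchwartzMap TensorProduct Classical Matrix ComplexConjugate NNReal
open Literature.NumberTheory.Automorphic Literature.NumberTheory.Automorphic.UnitaryGroup Literature.NumberTheory.Weil1964
open Literature.NumberTheory.Weil1964.ThetaKernelDatum Literature.NumberTheory.Li1992
open Literature.Geometry.ComplexHyperbolic.BallModel (U21 x₀)
open Literature.AlgebraicGeometry.ShimuraVarieties
open Literature.AlgebraicGeometry.Motives (CMType)
open Literature.NumberTheory.GelbartRogawski1991 Literature.NumberTheory.GelbartRogawski1991.UnitaryDualPair
open Literature.NumberTheory.GelbartRogawski1991.UnitaryDualPair.WeilCoinv (commute_comp_inl_comp_inr finPairToAdelic finPairRep)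
open Literature.NumberTheory.Automorphic.Liu2021
open Literature.NumberTheory.Automorphic.Liu2021.Def411WeilCarriers (omegaAtLine rhoVAtLine Chi TW JW JW_eq isSymm_TW isUnit_det_TW lineChar locF)
open Literature.NumberTheory.Automorphic.Liu2021.Def411WeilCarriersDoubling
open Literature.NumberTheory.GaloisRepresentations (HeckeCharacter)
open Literature.RepresentationTheory.HarrisKudlaSweet1996 (IsSplittingChar)
open Literature.RepresentationTheory.CompactGroups (charCM)
open Literature.MeasureTheory.Group
open HodgeCM HodgeCM.Adelic HodgeCM.PerL34 HodgeCM.Model HodgeCM.Model.ThetaSpace HodgeCM.Model.ArchSideTerm HodgeCM.Model.ThetaAdelicSide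
open HodgeCM.Model.ThetaDistFin HodgeCM.Model.HypCensus HodgeCM.Model.LiuIndex HodgeCM.Model.TowerCarrier HodgeCM.Model.SupplyResidual
open HodgeCM.Model.SupplyResidual.WeilPairData (charInv charInv_apply)
open Literature.Analysis.SegalBargmann (binvPi)
open Literature.AlgebraicGeometry.ShimuraVarieties (BallForms.isPullbackCocycle_cotangentCocycle BallForms.expP)
open Literature.AlgebraicGeometry.Liu2021 (IsAdmissibleElement)
open Summit.HodgeConjecture.CorCM Summit.HodgeConjecture.CorCM.Model Summit.HodgeConjecture.CorCM.Transposition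
open Summit.HodgeConjecture.CorCM.Transposition.OmegaChiSplitting (hsChiD)
open Summit.HodgeConjecture.HodgeConjecture.Cruxes.H413.CohFormsCarriers
open Summit.HodgeConjecture.HodgeConjecture.Cruxes.H413.CuspCot
open Summit.HodgeConjecture.HodgeConjecture.Cruxes.H413.ThetaDistAtLine
open Summit.HodgeConjecture.HodgeConjecture.Cruxes.H413.AdmissibleLine
open Summit.HodgeConjecture.HodgeConjecture.Cruxes.H413.ThetaNonvanishing
open Summit.HodgeConjecture.HodgeConjecture.Cruxes.H413.RallisTransport
open Summit.HodgeConjecture.HodgeConjecture.Cruxes.H413.ThetaJunction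

namespace Summit.HodgeConjecture.HodgeConjecture.Cruxes.H413.K2E2CapArchPackagedLineLift


/-! ## §0 Equal splittings give equal theta lifts (the `Prop`-valued arguments are irrelevant) -/

section Congr

variable (F₀ E₀ : Type) [Field F₀] [NumberField F₀] [Field E₀] [NumberField E₀] [Algebra F₀ E₀]
variable (c₀ : E₀ ≃ₐ[F₀] E₀) (N M : ℕ) {n : ℕ} (e : Fin N × Fin M ≃ Fin n)
variable (JV : Matrix (Fin N) (Fin N) E₀) (JW' : Matrix (Fin M) (Fin M) E₀)
variable {TV : Matrix (Fin N) (Fin N) F₀} {TW' : Matrix (Fin M) (Fin M) F₀}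
variable [Algebra.IsQuadraticExtension F₀ E₀] {δ : E₀} (hcδ : c₀ δ = -δ) (hδ : δ ≠ 0) {d : F₀}
  (hd : δ * δ = algebraMap F₀ E₀ d) (hV : TV.IsSymm) (hW : TW'.IsSymm) (hVd : IsUnit TV.det) (hWd : IsUnit TW'.det)
  (hJV : JV = TV.map (algebraMap F₀ E₀)) (hJW : JW' = TW'.map (algebraMap F₀ E₀))
variable [LocallyCompactSpace (UnitaryGroup.adelic F₀ E₀ c₀ N JV)] [LocallyCompactSpace (UnitaryGroup.adelic F₀ E₀ c₀ M JW')]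
variable {s₁ s₂ : UnitaryGroup.adelicPair F₀ E₀ c₀ N M JV JW' →* adelicMpCont F₀ (Fin n) (adelicGram F₀ e TV TW')}

/-- **Equal compatible splittings have equal theta lifts** (`subst`; majorants ∕ compatibility ∕ stability proofs are irrelevant). [folklore]
[cite: GelbartRogawski1991, §3.1 Prop. 3.1.1 p. 455] -/
theorem thetaLift_congr_splitting (h : s₁ = s₂)
    (hs₁ : (splittingDatum F₀ E₀ c₀ N M e JV JW' hcδ hδ hd hV hW hVd hWd hJV hJW).IsCompatible s₁)
    (hs₂ : (splittingDatum F₀ E₀ c₀ N M e JV JW' hcδ hδ hd hV hW hVd hWd hJV hJW).IsCompatible s₂)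
    (hρ₁ : HasThetaMajorants fun (p : UnitaryGroup.adelic F₀ E₀ c₀ N JV × UnitaryGroup.adelic F₀ E₀ c₀ M JW') (Φ : piSchwartzBruhat F₀ (Fin n)) =>
      pairRep F₀ E₀ c₀ N M e JV JW' s₁ p Φ)
    (hρ₂ : HasThetaMajorants fun (p : UnitaryGroup.adelic F₀ E₀ c₀ N JV × UnitaryGroup.adelic F₀ E₀ c₀ M JW') (Φ : piSchwartzBruhat F₀ (Fin n)) =>
      pairRep F₀ E₀ c₀ N M e JV JW' s₂ p Φ)
    (SK : Set (piSchwartzBruhat F₀ (Fin n)))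
    (hSK₁ : ∀ (h : UnitaryGroup.adelic F₀ E₀ c₀ M JW') (Φ : piSchwartzBruhat F₀ (Fin n)), Φ ∈ SK → pairRep F₀ E₀ c₀ N M e JV JW' s₁ (1, h) Φ ∈ SK)
    (hSK₂ : ∀ (h : UnitaryGroup.adelic F₀ E₀ c₀ M JW') (Φ : piSchwartzBruhat F₀ (Fin n)), Φ ∈ SK → pairRep F₀ E₀ c₀ N M e JV JW' s₂ (1, h) Φ ∈ SK)
    [CompactSpace (UnitaryGroup.adelic F₀ E₀ c₀ N JV ⧸ (UnitaryGroup.toAdelic F₀ E₀ c₀ N JV).range)]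
    [CompactSpace (UnitaryGroup.adelic F₀ E₀ c₀ M JW' ⧸ (UnitaryGroup.toAdelic F₀ E₀ c₀ M JW').range)]
    [MeasurableSpace (UnitaryGroup.adelic F₀ E₀ c₀ M JW' ⧸ (UnitaryGroup.toAdelic F₀ E₀ c₀ M JW').range)]
    [BorelSpace (UnitaryGroup.adelic F₀ E₀ c₀ M JW' ⧸ (UnitaryGroup.toAdelic F₀ E₀ c₀ M JW').range)]
    (μ : Measure (UnitaryGroup.adelic F₀ E₀ c₀ M JW' ⧸ (UnitaryGroup.toAdelic F₀ E₀ c₀ M JW').range)) [IsFiniteMeasure μ]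
    (Φ : piSchwartzBruhat F₀ (Fin n)) (f : C(UnitaryGroup.adelic F₀ E₀ c₀ M JW' ⧸ (UnitaryGroup.toAdelic F₀ E₀ c₀ M JW').range, ℂ))
    (ξ : UnitaryGroup.adelic F₀ E₀ c₀ N JV ⧸ (UnitaryGroup.toAdelic F₀ E₀ c₀ N JV).range) :
    (thetaKernelDatum F₀ E₀ c₀ N M e JV JW' hcδ hδ hd hV hW hVd hWd hJV hJW s₁ hs₁ hρ₁ SK hSK₁).thetaLift μ Φ f ξ =
      (thetaKernelDatum F₀ E₀ c₀ N M e JV JW' hcδ hδ hd hV hW hVd hWd hJV hJW s₂ hs₂ hρ₂ SK hSK₂).thetaLift μ Φ f ξ := by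
  subst h
  rfl

end Congr

/-! ## §1 Two line facts (the ★ `F0P2tChiNGen` private helpers, restated privately) -/

/-- through every complex embedding a real non-zero line scalar has ONE strict sign. [folklore] -/
private theorem re_line_sign (L : Type) [Field L] [NumberField L] [IsCMField L] (τ : L →+* ℂ) (a : L)
    (ha : IsCMField.complexConj L a = a) (ha0 : a ≠ 0) :
    (∀ j : Fin 1, 0 < (τ (lineVec L a j)).re) ∨ ∀ j : Fin 1, (τ (lineVec L a j)).re < 0 := by
  rcases lt_or_gt_of_ne (Literature.NumberTheory.Weil1964.re_apply_ne_zero_of_complexConj_eq L τ ha ha0) with h | h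
  · exact Or.inr fun _ => h
  · exact Or.inl fun _ => h

/-! ## §2 H1′-core -/


set_option synthInstance.maxHeartbeats 400000 in
set_option maxHeartbeats 16000000 in
/-- **H1′-core: THE LINE THETA PAIR OF THE PACKAGED FRAME IS A HOLOMORPHIC COTANGENT FORM of `archFactorOf F V`** (see the module docstring; binders = the
engine's `hχN` currency, token for token, then `∀ hρμ [Borel] w Φ_f`).
[cite: Liu2021, App. D §D.1 Steps 1–3, Lem. D.2 (2)] [cite: KonnoKonno2007, Thm 5.4] [cite: GelbartRogawski1991, §3.1 Prop. 3.1.1 p. 455; Remark p. 457 L4–13]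
[cite: Weil1964, Chap. III n° 41 Thm 6 p. 193] [cite: BorelJacquet1979, §4.1, §4.2] -/
theorem lineLiftPair_mem_holCotForms_archFactorOf :
    ∀ (F : HodgeCM.CMField) {ι₁ : F →+* ℂ} (V : HodgeCM.HermSpace3 F ι₁) (h4 : 4 ≤ Module.finrank ℚ F.K) (Φ : CMType F)
      (μ₀ : Literature.NumberTheory.Automorphic.IdeleClassGroup F.K →ₜ* Circle)
      (hμ₀ : Literature.NumberTheory.Automorphic.IdeleClassGroup.IsConjugateSymplectic F.K μ₀)
      (hw : Literature.NumberTheory.Automorphic.IdeleClassGroup.HasWeight F.K μ₀ 1)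
      (hmem : (InfinitePlace.mk ι₁).embedding ∈ hμ₀.cmType.1)
      (χ : Chi (↥(maximalRealSubfield F.K)) F.K (IsCMField.complexConj F.K))
      (e : F.K) (a : (↥(maximalRealSubfield F.K))ˣ)
      (he : Literature.AlgebraicGeometry.Liu2021.IsAdmissibleElement F.K hμ₀.cmType.1 e)
      (hae : (a : F.K) = e * (2 * imagUnit F.K)),
      ∀ (hV : IsAnisotropic F (HodgeCM.HermSpace3.Hm V)) (ha : IsCMField.complexConj F.K (a : F.K) = (a : F.K)) (ha0 : (a : F.K) ≠ 0)
      (hpos : 0 < cmXW F.K (frameD V) (lineVec F.K (dW (cDiag Φ ι₁ (a : F.K) ha ha0).D 0)) (fun _ => dW_real (cDiag Φ ι₁ (a : F.K) ha ha0).D 0) ι₁ (cmPlace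
          F.K ι₁) 0)
      (ĉ : UnitaryGroup.adelicPair (↥(maximalRealSubfield F.K)) F.K (IsCMField.complexConj F.K) 3 1
        (Matrix.diagonal (frameD V)) (Matrix.diagonal (lineVec F.K (a : F.K))) →* ℂˣ),
      (chiSplitting F.K e₁ (frameD V) (frameD_real V) (frameD_ne V) (lineVec F.K (a : F.K)) (complexConj_lineVec_coe F.K a) (lineVec_coe_ne_zero F.K a)
          (Literature.NumberTheory.Automorphic.IdeleClassGroup.toHeckeCharacter F.K μ₀) (Literature.NumberTheory.Automorphic.IdeleClassGroup.isUnitary_toHeckeCharacter F.K μ₀)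
              ((Literature.RepresentationTheory.Liu2021.isOscillatorChar_toHeckeCharacter_iff μ₀).mpr hμ₀)) =
        adelicMpCont.twist (↥(maximalRealSubfield F.K)) (Fin 3) _ (splittingOf _ _ _ _ _ _ _ _ _ _ _ _ _ _ _ _ _ (compat_line₀ V Φ ι₁ (a : F.K) ha ha0)) ĉ →
      (∀ γU ∈ (UnitaryGroup.toAdelic (↥(maximalRealSubfield F.K)) F.K (IsCMField.complexConj F.K) 3 (Matrix.diagonal (frameD V))).range, ĉ ((UnitaryGroup.adelicInl
          (↥(maximalRealSubfield F.K)) F.K (IsCMField.complexConj F.K) 3 1 (Matrix.diagonal (frameD V)) (Matrix.diagonal (lineVec F.K (a : F.K)))) γU) = 1) →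
      (∀ γ ∈ (UnitaryGroup.toAdelic (↥(maximalRealSubfield F.K)) F.K (IsCMField.complexConj F.K) 1 (Matrix.diagonal (lineVec F.K (a : F.K)))).range, ĉ ((UnitaryGroup.adelicInr
          (↥(maximalRealSubfield F.K)) F.K (IsCMField.complexConj F.K) 3 1 (Matrix.diagonal (frameD V)) (Matrix.diagonal (lineVec F.K (a : F.K)))) γ) = 1) →
      Continuous ĉ →
      ∀ (hν : ∀ γU ∈ CMRat F.K (frameD V), ((cmLineChar₀ F.K finProdFinEquiv e₁ (frameD V) (frameD_real V) (frameD_ne V) (dW (cDiag Φ ι₁ (a : F.K) ha ha0).D) (dW_real (cDiag Φ ι₁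
          (a : F.K) ha ha0).D) (dW_ne (cDiag Φ ι₁ (a : F.K) ha ha0).D) (compat_plane V Φ ι₁ (a : F.K) ha ha0) (compat_line₀ V Φ ι₁ (a : F.K) ha ha0) (compat_line₁ V Φ ι₁
          (a : F.K) ha ha0)).comp (MonoidHom.inl _ _) * (ĉ.comp (UnitaryGroup.adelicInl (↥(maximalRealSubfield F.K)) F.K (IsCMField.complexConj
          F.K) 3 1 (Matrix.diagonal (frameD V)) (Matrix.diagonal (lineVec F.K (a : F.K)))))⁻¹) γU = 1)
        (hνc : Continuous fun v => ((((cmLineChar₀ F.K finProdFinEquiv e₁ (frameD V) (frameD_real V) (frameD_ne V) (dW (cDiag Φ ι₁ (a : F.K) ha ha0).D) (dW_real (cDiag Φ ι₁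
            (a : F.K) ha ha0).D) (dW_ne (cDiag Φ ι₁ (a : F.K) ha ha0).D) (compat_plane V Φ ι₁ (a : F.K) ha ha0) (compat_line₀ V Φ ι₁ (a : F.K) ha ha0) (compat_line₁ V Φ ι₁
            (a : F.K) ha ha0)).comp (MonoidHom.inl _ _) * (ĉ.comp (UnitaryGroup.adelicInl (↥(maximalRealSubfield F.K)) F.K (IsCMField.complexConj F.K) 3 1 (Matrix.diagonal (frameD V))
            (Matrix.diagonal (lineVec F.K (a : F.K)))))⁻¹) v : ℂˣ) : ℂ))
        (A : ∀ k : Fin 4, ArchLineInput V (lineRepT V (cDiag Φ ι₁ (a : F.K) ha ha0).D (compat_plane V Φ ι₁ (a : F.K) ha ha0) (compat_line₀ V Φ ι₁ (a : F.K) ha ha0) (compat_line₁ V Φ ι₁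
            (a : F.K) ha ha0) (compat_line₂ V Φ ι₁ (a : F.K) ha ha0) (compat_line₃ V Φ ι₁ (a : F.K) ha ha0) (1 : CMAdelic F.K (frameD V) × CMAdelic F.K (dW (cDiag Φ ι₁
            (a : F.K) ha ha0).D) →* ℂˣ) ((cmLineChar₀ F.K finProdFinEquiv e₁ (frameD V) (frameD_real V)
            (frameD_ne V) (dW (cDiag Φ ι₁ (a : F.K) ha ha0).D) (dW_real (cDiag Φ ι₁ (a : F.K) ha ha0).D) (dW_ne (cDiag Φ ι₁ (a : F.K) ha ha0).D) (compat_plane V Φ ι₁ (a : F.K) ha ha0)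
                (compat_line₀ V Φ ι₁ (a : F.K) ha ha0) (compat_line₁ V Φ ι₁ (a : F.K) ha ha0)).comp (MonoidHom.inl _ _) * (ĉ.comp (UnitaryGroup.adelicInl (↥(maximalRealSubfield F.K)) F.K
                (IsCMField.complexConj F.K) 3 1 (Matrix.diagonal (frameD V)) (Matrix.diagonal (lineVec F.K (a : F.K)))))⁻¹) k))
        (harm : ∀ (u : ↥(stabilizer U21 x₀)) (ℓ : Module.Dual ℂ (Fin 2 → ℂ)),
          lineOmega_zero V (cDiag Φ ι₁ (a : F.K) ha ha0).D (compat_plane V Φ ι₁ (a : F.K) ha ha0) (compat_line₀ V Φ ι₁ (a : F.K)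
              ha ha0) (compat_line₁ V Φ ι₁ (a : F.K) ha ha0) (etaT₀ V (cDiag Φ ι₁ (a : F.K) ha ha0).D (1 : CMAdelic F.K (frameD V) × CMAdelic F.K (dW (cDiag Φ
              ι₁ (a : F.K) ha ha0).D) →* ℂˣ) ((cmLineChar₀ F.K finProdFinEquiv e₁ (frameD V) (frameD_real V) (frameD_ne V) (dW (cDiag Φ ι₁ (a : F.K) ha ha0).D) (dW_real (cDiag Φ
              ι₁ (a : F.K) ha ha0).D) (dW_ne (cDiag Φ ι₁ (a : F.K) ha ha0).D) (compat_plane V Φ ι₁ (a : F.K) ha ha0)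
              (compat_line₀ V Φ ι₁ (a : F.K) ha ha0) (compat_line₁ V Φ ι₁ (a : F.K) ha ha0)).comp (MonoidHom.inl _ _) * (ĉ.comp (UnitaryGroup.adelicInl (↥(maximalRealSubfield F.K)) F.K
                  (IsCMField.complexConj F.K) 3 1 (Matrix.diagonal (frameD V)) (Matrix.diagonal (lineVec F.K (a : F.K)))))⁻¹)) (u : U21) ((blockFamilyOfAt F.K e₁ (frameD V) (frameD_real
              V) (frameD_ne V) (lineVec F.K (dW (cDiag Φ ι₁ (a : F.K) ha ha0).D 0)) (fun _ => dW_real (cDiag Φ ι₁ (a : F.K) ha ha0).D 0) (fun _ => dW_ne (cDiag Φ ι₁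
                  (a : F.K) ha ha0).D 0) ι₁ (blockPosEquiv V) (blockNegEquiv V) (posIdxEquivUnit hpos) (negIdxEquivEmpty hpos) (degOnePDual Empty) (binvPi 1)) ℓ) =
            (blockFamilyOfAt F.K e₁ (frameD V) (frameD_real V) (frameD_ne V) (lineVec F.K (dW (cDiag Φ ι₁ (a : F.K) ha ha0).D 0)) (fun _ => dW_real (cDiag Φ ι₁ (a : F.K) ha ha0).D 0)
                (fun _ => dW_ne (cDiag Φ ι₁ (a : F.K) ha ha0).D 0) ι₁ (blockPosEquiv V) (blockNegEquiv V) (posIdxEquivUnit hpos) (negIdxEquivEmpty hpos) (degOnePDual Empty) (binvPi 1))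
                ((BallForms.isPullbackCocycle_cotangentCocycle.weightOf x₀).dual u ℓ))
        (hdef : ∀ g : UnitaryGroup.arch (↥(maximalRealSubfield F.K)) F.K (IsCMField.complexConj F.K) 3 V.Hm,
          UnitaryGroup.archAt (↥(maximalRealSubfield F.K)) F.K (IsCMField.complexConj F.K) 3 V.Hm (UnitaryGroup.cmPlace F.K ι₁) (NumberField.complexConj_smul_infinitePlace F.K _)
              (IsCMField.complexConj_ne_one F.K) g = 1 →
          ∀ (ℓ : Module.Dual ℂ (Fin 2 → ℂ)) (Φf : FinSB (↥(maximalRealSubfield F.K)) (Fin 3)),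
            lineRepOf V (cDiag Φ ι₁ (a : F.K) ha ha0).D (compat_plane V Φ ι₁ (a : F.K) ha ha0) (compat_line₀ V Φ ι₁ (a : F.K) ha
                ha0) (compat_line₁ V Φ ι₁ (a : F.K) ha ha0) (compat_line₂ V Φ ι₁ (a : F.K) ha ha0) (compat_line₃ V Φ ι₁ (a : F.K) ha ha0) (etaT₀ V (cDiag Φ ι₁ (a : F.K) ha ha0).D
                    (1 : CMAdelic F.K (frameD V) × CMAdelic F.K (dW (cDiag Φ ι₁ (a : F.K) ha ha0).D) →* ℂˣ)
                ((cmLineChar₀ F.K finProdFinEquiv e₁ (frameD V) (frameD_real V) (frameD_ne V) (dW (cDiag Φ ι₁ (a : F.K) ha ha0).D) (dW_real (cDiag Φ ι₁ (a : F.K) ha ha0).D)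
                (dW_ne (cDiag Φ ι₁ (a : F.K) ha ha0).D) (compat_plane V Φ ι₁ (a : F.K) ha ha0) (compat_line₀ V Φ ι₁ (a : F.K) ha
                ha0) (compat_line₁ V Φ ι₁ (a : F.K) ha ha0)).comp (MonoidHom.inl _ _) * (ĉ.comp (UnitaryGroup.adelicInl (↥(maximalRealSubfield F.K)) F.K (IsCMField.complexConj F.K) 3 1
                    (Matrix.diagonal
                (frameD V)) (Matrix.diagonal (lineVec F.K (a : F.K)))))⁻¹))
                (etaT₁ V (cDiag Φ ι₁ (a : F.K) ha ha0).D (1 : CMAdelic F.K (frameD V) × CMAdelic F.K (dW (cDiag Φ ι₁ (a : F.K) ha ha0).D) →* ℂˣ) ((cmLineChar₀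
                    F.K finProdFinEquiv e₁ (frameD V) (frameD_real V) (frameD_ne V) (dW (cDiag Φ ι₁ (a : F.K) ha ha0).D) (dW_real (cDiag Φ ι₁ (a : F.K) ha ha0).D) (dW_ne (cDiag
                    Φ ι₁ (a : F.K) ha ha0).D) (compat_plane V Φ ι₁ (a : F.K) ha ha0) (compat_line₀ V Φ ι₁ (a : F.K) ha ha0)
                    (compat_line₁ V Φ ι₁ (a : F.K) ha ha0)).comp (MonoidHom.inl _ _) * (ĉ.comp (UnitaryGroup.adelicInl (↥(maximalRealSubfield F.K)) F.K (IsCMField.complexConj F.K) 3 1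
                        (Matrix.diagonal (frameD
                    V)) (Matrix.diagonal (lineVec F.K (a : F.K)))))⁻¹)) (eta₂ V (cDiag Φ ι₁ (a : F.K) ha ha0).D (1 : CMAdelic F.K (frameD V) × CMAdelic
                    F.K (dW (cDiag Φ ι₁ (a : F.K) ha ha0).D) →* ℂˣ)) (eta₃ V (cDiag Φ ι₁ (a : F.K) ha ha0).D (1 : CMAdelic F.K (frameD V) × CMAdelic
                    F.K (dW (cDiag Φ ι₁ (a : F.K) ha ha0).D) →* ℂˣ)) 0
                (HodgeCM.Adelic.regimeEquiv F V.Hm hV (UnitaryGroup.archToAdelic (↥(maximalRealSubfield F.K)) F.K (IsCMField.complexConj F.K) 3 V.Hm g), 1)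
                (piSchwartzBruhatEquiv (↥(maximalRealSubfield F.K)) (Fin 3) ((blockFamilyOfAt F.K e₁ (frameD V) (frameD_real V) (frameD_ne V) (lineVec F.K (dW (cDiag Φ ι₁
                    (a : F.K) ha ha0).D 0)) (fun _ =>
                    dW_real (cDiag Φ ι₁ (a : F.K) ha ha0).D 0) (fun _ => dW_ne (cDiag Φ ι₁ (a : F.K) ha ha0).D 0) ι₁ (blockPosEquiv V) (blockNegEquiv V) (posIdxEquivUnit hpos)
                        (negIdxEquivEmpty
                    hpos) (degOnePDual Empty) (binvPi 1)) ℓ ⊗ₜ[ℂ] Φf)) =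
              piSchwartzBruhatEquiv (↥(maximalRealSubfield F.K)) (Fin 3) ((blockFamilyOfAt F.K e₁ (frameD V) (frameD_real V) (frameD_ne V) (lineVec F.K (dW (cDiag Φ ι₁
                  (a : F.K) ha ha0).D 0)) (fun _ =>
                  dW_real (cDiag Φ ι₁ (a : F.K) ha ha0).D 0) (fun _ => dW_ne (cDiag Φ ι₁ (a : F.K) ha ha0).D 0) ι₁ (blockPosEquiv V) (blockNegEquiv V) (posIdxEquivUnit hpos)
                      (negIdxEquivEmpty
                  hpos) (degOnePDual Empty) (binvPi 1)) ℓ ⊗ₜ[ℂ] Φf)),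
      ∀ (hemb : (InfinitePlace.mk ι₁).embedding = ι₁) (hρμ : HasThetaMajorants fun
          (p : CMAdelic F.K (frameD V) × CMAdelic F.K (lineVec F.K (a : F.K))) (Φ' : piSchwartzBruhat ↥(maximalRealSubfield F.K) (Fin 3)) =>
            pairRep ↥(maximalRealSubfield F.K) F.K (IsCMField.complexConj F.K) 3 1 e₁ (Matrix.diagonal (frameD V)) (Matrix.diagonal (lineVec F.K (a : F.K)))
              (chiSplitting F.K e₁ (frameD V) (frameD_real V) (frameD_ne V) (lineVec F.K (a : F.K)) (complexConj_lineVec_coe F.K a) (lineVec_coe_ne_zero F.K a)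
                  (IdeleClassGroup.toHeckeCharacter F.K μ₀) (IdeleClassGroup.isUnitary_toHeckeCharacter F.K μ₀)
                  ((Literature.RepresentationTheory.Liu2021.isOscillatorChar_toHeckeCharacter_iff μ₀).mpr hμ₀)) p Φ')
        [MeasurableSpace (CMAdelic F.K (lineVec F.K (a : F.K)) ⧸ CMRat F.K (lineVec F.K (a : F.K)))] [BorelSpace (CMAdelic F.K (lineVec F.K (a : F.K)) ⧸ CMRat F.K (lineVec F.K (a : F.K)))]
        [CompactSpace (CMAdelic F.K (frameD V) ⧸ CMRat F.K (frameD V))] (w : C((CMAdelic F.K (lineVec F.K (a : F.K)) ⧸ CMRat F.K (lineVec F.K (a : F.K))), ℂ))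
            (Φf : FinSB ↥(maximalRealSubfield F.K) (Fin 3)),
        (fun (x : (CohFormsCarriers.adelicDatum F V).Adelic) (j : Fin 2) =>
            (thetaKernelDatum ↥(maximalRealSubfield F.K) F.K (IsCMField.complexConj F.K) 3 1 e₁ (Matrix.diagonal (frameD V)) (Matrix.diagonal (lineVec F.K (a : F.K)))
                (complexConj_imagUnit F.K) (imagUnit_ne_zero F.K) (imagUnit_mul_self F.K) (realDiagonal_isSymm F.K (frameD V) (frameD_real V)) (realDiagonal_isSymm F.K _
                (complexConj_lineVec_coe F.K a)) (isUnit_det_realDiagonal F.K (frameD V) (frameD_real V) (frameD_ne V)) (isUnit_det_realDiagonal F.K _ (complexConj_lineVec_coe F.K a)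
                (lineVec_coe_ne_zero F.K a)) (realDiagonal_map F.K (frameD V) (frameD_real V)).symm (realDiagonal_map F.K _ (complexConj_lineVec_coe F.K a)).symm
                (chiSplitting F.K e₁ (frameD V) (frameD_real V) (frameD_ne V) (lineVec F.K (a : F.K)) (complexConj_lineVec_coe F.K a) (lineVec_coe_ne_zero F.K a)
                    (IdeleClassGroup.toHeckeCharacter F.K μ₀) (IdeleClassGroup.isUnitary_toHeckeCharacter F.K μ₀)
                    ((Literature.RepresentationTheory.Liu2021.isOscillatorChar_toHeckeCharacter_iff μ₀).mpr hμ₀))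
                (isCompatible_chiSplitting F.K e₁ (frameD V) (frameD_real V) (frameD_ne V) _ (complexConj_lineVec_coe F.K a) (lineVec_coe_ne_zero F.K a)
                    (IdeleClassGroup.toHeckeCharacter F.K μ₀) (IdeleClassGroup.isUnitary_toHeckeCharacter F.K μ₀)
                    ((Literature.RepresentationTheory.Liu2021.isOscillatorChar_toHeckeCharacter_iff μ₀).mpr hμ₀))
                hρμ Set.univ (fun _ _ _ => Set.mem_univ _)).thetaLiftFun
              ((probHaarRelNormOneQuot ↥(maximalRealSubfield F.K) F.K).map (cosetCongr (cmLineTorusEquiv F.K (a : F.K) ha0) (relNormOneRat ↥(maximalRealSubfield F.K) F.K) (CMRat F.K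
                  (lineVec F.K (a : F.K))) (cmLineTorusEquiv_mem_CMRat_iff F.K (a : F.K) ha0)))
              (piSchwartzBruhatEquiv ↥(maximalRealSubfield F.K) (Fin 3)
                ((blockFamilyOfAt F.K e₁ (frameD V) (frameD_real V) (frameD_ne V) (lineVec F.K (dW (cDiag Φ ι₁ (a : F.K) ha ha0).D 0)) (fun _ => dW_real (cDiag Φ ι₁ (a : F.K) ha ha0).D 0)
                    (fun _ => dW_ne (cDiag Φ ι₁ (a : F.K) ha ha0).D 0) ι₁ (blockPosEquiv V) (blockNegEquiv V) (posIdxEquivUnit hpos) (negIdxEquivEmpty hpos) (degOnePDual Empty) (binvPi 1))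
                  (LinearMap.proj j) ⊗ₜ[ℂ] Φf)) w
              (cmAdelicFrameTransport F.K 3 (HodgeCM.HermSpace3.Hm V) (frameD V) (frameG V) (frame_congr V) x)) ∈
          CohFormsCarriers.holCotForms (CohFormsCarriers.archFactorOf F V) := by
  intro F ι₁ V h4 Φ μ₀ hμ₀ hw hmem χ e a he hae hV ha ha0 hpos ĉ hĉ hĉV hĉW hĉc hν hνc A harm hdef hemb hρμ mW hBW hcV w Φf
  haveI hnormal : (CMRat F.K (lineVec F.K (a : F.K))).Normal :=
    Def411WeilCarriers.normal_range_toAdelic_line ↥(maximalRealSubfield F.K) F.K (IsCMField.complexConj F.K) _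
  haveI hcW : CompactSpace (CMAdelic F.K (lineVec F.K (a : F.K)) ⧸ CMRat F.K (lineVec F.K (a : F.K))) := compactSpace_quotient_range_toAdelic_line F.K _ (fun _ => ha) (fun _ => ha0)
  have hρ₀ := hasThetaMajorants_cmPairSplitting_of_signs F.K e₁ (frameD V) (frameD_real V) (frameD_ne V) (lineVec F.K (a : F.K)) (fun _ => ha) (fun _ => ha0) ι₁
    (compat_line₀ V Φ ι₁ (a : F.K) ha ha0) (frameD_sign_ι₁' V) (re_line_sign F.K ι₁ _ ha ha0) (frameD_sign_of_ne V)
    (fun _ _ => Or.inl ⟨0, fun j hj => absurd (Subsingleton.elim j 0) hj⟩)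
  have hSK : ∀ (h : CMAdelic F.K (lineVec F.K (a : F.K))) (Φ' : piSchwartzBruhat ↥(maximalRealSubfield F.K) (Fin 3)), Φ' ∈ (Set.univ : Set _) →
      cmPairRep F.K e₁ (frameD V) (frameD_real V) (frameD_ne V) (lineVec F.K (a : F.K)) (fun _ => ha) (fun _ => ha0) (compat_line₀ V Φ ι₁ (a : F.K) ha ha0) (1, h) Φ' ∈ (Set.univ : Set _) :=
    fun _ _ _ => Set.mem_univ _
  -- the twisted splitting `splittingOf ⊗ ĉ` IS `chiSplitting(μ₀)`: compatibility and majorants are transported ALONG `hĉ` (no restatement)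
  have hs' := (isCompatible_chiSplitting F.K e₁ (frameD V) (frameD_real V) (frameD_ne V) _ (complexConj_lineVec_coe F.K a) (lineVec_coe_ne_zero F.K a)
      (IdeleClassGroup.toHeckeCharacter F.K μ₀) (IdeleClassGroup.isUnitary_toHeckeCharacter F.K μ₀)
      ((Literature.RepresentationTheory.Liu2021.isOscillatorChar_toHeckeCharacter_iff μ₀).mpr hμ₀))
  rw [hĉ] at hs'
  have hρ' := hρμ
  rw [hĉ] at hρ'
  -- the `U(W)`-multiplier of the splitting twist, `κ₂([h]) = ĉ(1 ⊗ h)`, nowhere zero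
  have hĉc' : Continuous fun h : CMAdelic F.K (lineVec F.K (a : F.K)) =>
      ((ĉ (UnitaryGroup.adelicInr ↥(maximalRealSubfield F.K) F.K (IsCMField.complexConj F.K) 3 1 (Matrix.diagonal (frameD V)) (Matrix.diagonal (lineVec F.K (a : F.K))) h) : ℂˣ) : ℂ) :=
    Units.continuous_val.comp (hĉc.comp (UnitaryGroup.continuous_adelicInr _ _ _ _ _ _ _))
  obtain ⟨κ₂, hκ₂⟩ := exists_kappa_of_twist_splitting ↥(maximalRealSubfield F.K) F.K (IsCMField.complexConj F.K) 3 1 e₁ (Matrix.diagonal (frameD V)) (Matrix.diagonal (lineVec F.K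
      (a : F.K))) (complexConj_imagUnit F.K) (imagUnit_ne_zero F.K) (imagUnit_mul_self F.K) (realDiagonal_isSymm F.K (frameD V) (frameD_real V)) (realDiagonal_isSymm F.K _
      (complexConj_lineVec_coe F.K a)) (isUnit_det_realDiagonal F.K (frameD V) (frameD_real V) (frameD_ne V)) (isUnit_det_realDiagonal F.K _ (complexConj_lineVec_coe F.K a)
      (lineVec_coe_ne_zero F.K a)) (realDiagonal_map F.K (frameD V) (frameD_real V)).symm (realDiagonal_map F.K _ (complexConj_lineVec_coe F.K a)).symm
    (splittingOf_isCompatible _ _ _ _ _ _ _ _ _ _ _ _ _ _ _ _ _ (compat_line₀ V Φ ι₁ (a : F.K) ha ha0)) ĉ hs' hĉc'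
  have hκ₂0 : ∀ q : (CMAdelic F.K (lineVec F.K (a : F.K)) ⧸ CMRat F.K (lineVec F.K (a : F.K))), κ₂ q ≠ 0 := fun q => by
    induction q using QuotientGroup.induction_on with
    | H h => rw [hκ₂ h]; exact Units.ne_zero _
  -- the model's `U(1)`-multiplier `κ₁` (★ `RallisTransport.exists_kappa`, as in ★ `F0P2tChiNGen`; `P := (sideAt …).P 0`, `η := 1`)
  have hη₀c := continuous_etaT₀ V (cDiag Φ ι₁ (a : F.K) ha ha0).D 1 _ (continuous_one_val V (cDiag Φ ι₁ (a : F.K) ha ha0)) hνc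
  have hχ₀c := continuous_cmLineChar₀_of_signs F.K finProdFinEquiv e₁ (frameD V) (frameD_real V) (frameD_ne V) (dW (cDiag Φ ι₁ (a : F.K) ha ha0).D) (dW_real (cDiag Φ ι₁ (a : F.K) ha ha0).D)
    (dW_ne (cDiag Φ ι₁ (a : F.K) ha ha0).D) (compat_plane V Φ ι₁ (a : F.K) ha ha0) (compat_line₀ V Φ ι₁ (a : F.K) ha ha0) (compat_line₁ V Φ ι₁ (a : F.K) ha ha0) ι₁ (frameD_sign_ι₁' V)
        (h₁W_cDiag Φ ι₁ (a : F.K) ha ha0) (frameD_sign_of_ne V)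
  obtain ⟨κ₁, hκ₁⟩ := exists_kappa V (cDiag Φ ι₁ (a : F.K) ha ha0).D (compat_plane V Φ ι₁ (a : F.K) ha ha0) (compat_line₀ V Φ ι₁ (a : F.K) ha ha0) (compat_line₁ V Φ ι₁ (a : F.K) ha ha0)
      (compat_line₂ V Φ ι₁ (a : F.K) ha ha0) (compat_line₃ V Φ ι₁ (a : F.K) ha ha0) _ _ _ _
    ((HodgeCM.Adelic.regimeEquiv F V.Hm hV).symm.trans (cmFrameEquiv F.K (frameG V) V.Hm (frameD V) (frame_congr V))).toMulEquiv
    (fun _ => rfl) (cmLineTorusEquiv F.K (a : F.K) ha0) (cmLineTorusEquiv_apply F.K (a : F.K) ha0) _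
    (sideAt_P_ω V Φ ι₁ (a : F.K) ha ha0 (1 : CMAdelic F.K (frameD V) × CMAdelic F.K (dW (cDiag Φ ι₁ (a : F.K) ha ha0).D) →* ℂˣ) (one_apply_rat_eq_one V (cDiag Φ ι₁ (a : F.K) ha ha0))
        (continuous_one_val V (cDiag Φ ι₁ (a : F.K) ha ha0)) _ hν hνc A 0) (ThetaAdelicSide.hΓU _ 0) (cmLineTorusEquiv_mem_CMRat_iff F.K (a : F.K) ha0)
    (by
      simp only [Units.val_mul]
      exact (hη₀c.comp (continuous_const.prodMk (continuous_cmAdelicOneEquivRelNormOne_symm F.K))).mul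
        (hχ₀c.comp (continuous_const.prodMk (continuous_cmLineTorusEquiv F.K (a : F.K) ha0))))
  -- the model weight `f_model := ((w·κ₂⁻¹) ∘ a)·κ₁`
  let f : C((CMAdelic F.K (lineVec F.K (a : F.K)) ⧸ CMRat F.K (lineVec F.K (a : F.K))), ℂ) := w * ⟨fun q => (κ₂ q)⁻¹, κ₂.continuous.inv₀ hκ₂0⟩
  have hfw : f * κ₂ = w := by
    ext q
    show w q * (κ₂ q)⁻¹ * κ₂ q = w q
    rw [mul_assoc, inv_mul_cancel₀ (hκ₂0 q), mul_one]
  let fmodel : C(↥(relNormOneIdeles ↥(maximalRealSubfield F.K) F.K) ⧸ relNormOneRat ↥(maximalRealSubfield F.K) F.K, ℂ) :=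
    f.comp ⟨(cosetCongr (cmLineTorusEquiv F.K (a : F.K) ha0) (relNormOneRat ↥(maximalRealSubfield F.K) F.K) (CMRat F.K (lineVec F.K (a : F.K))) (cmLineTorusEquiv_mem_CMRat_iff F.K
        (a : F.K) ha0)), continuous_cosetCongr _ _ _ _ (continuous_cmLineTorusEquiv F.K (a : F.K) ha0)⟩ * κ₁
  -- the model's slot-`0` theta-distribution datum at the line (η := 1, the engine's knob `ν`, its harmonic family), and its theta form of `(f_model, Φ_f)`:
  -- a holomorphic cotangent form of `archFactorOf F V` (★ `funLeft_latticeEquiv_dist_mem_holCotForms_sideAt` with the engine's free rows)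
  letI D := distDatumAt V Φ ι₁ (a : F.K) ha ha0 (1 : CMAdelic F.K (frameD V) × CMAdelic F.K (dW (cDiag Φ ι₁ (a : F.K) ha ha0).D) →* ℂˣ) (one_apply_rat_eq_one V (cDiag Φ ι₁
      (a : F.K) ha ha0)) (continuous_one_val V (cDiag Φ ι₁ (a : F.K) ha ha0)) _ hν hνc A hV
    (blockFamilyOfAt F.K e₁ (frameD V) (frameD_real V) (frameD_ne V) (lineVec F.K (dW (cDiag Φ ι₁ (a : F.K) ha ha0).D 0)) (fun _ => dW_real (cDiag Φ ι₁ (a : F.K) ha ha0).D 0)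
        (fun _ => dW_ne (cDiag Φ ι₁ (a : F.K) ha ha0).D 0) ι₁ (blockPosEquiv V) (blockNegEquiv V) (posIdxEquivUnit hpos) (negIdxEquivEmpty hpos) (degOnePDual Empty) (binvPi 1))
    harm hdef
  obtain ⟨K, hKo, hK⟩ := D.smooth Φf
  have hmem := funLeft_latticeEquiv_dist_mem_holCotForms_sideAt F V hV Φ ι₁ (a : F.K) ha ha0 (1 : CMAdelic F.K (frameD V) × CMAdelic F.K (dW (cDiag Φ ι₁ (a : F.K) ha ha0).D) →* ℂˣ)
      (one_apply_rat_eq_one V (cDiag Φ ι₁ (a : F.K) ha ha0)) (continuous_one_val V (cDiag Φ ι₁ (a : F.K) ha ha0)) _ hν hνc A D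
    (isLFAction_sideAt V Φ ι₁ (a : F.K) ha ha0 (1 : CMAdelic F.K (frameD V) × CMAdelic F.K (dW (cDiag Φ ι₁ (a : F.K) ha ha0).D) →* ℂˣ) (one_apply_rat_eq_one V (cDiag Φ ι₁
        (a : F.K) ha ha0)) (continuous_one_val V (cDiag Φ ι₁ (a : F.K) ha ha0)) _ hν hνc A 0)
    (hd_of_eq V Φ ι₁ (a : F.K) ha ha0 (1 : CMAdelic F.K (frameD V) × CMAdelic F.K (dW (cDiag Φ ι₁ (a : F.K) ha ha0).D) →* ℂˣ) (one_apply_rat_eq_one V (cDiag Φ ι₁ (a : F.K) ha ha0))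
        (continuous_one_val V (cDiag Φ ι₁ (a : F.K) ha ha0)) _ hν hνc A hV hpos hemb D rfl rfl)
    (hCR_of_eq V Φ ι₁ (a : F.K) ha ha0 (1 : CMAdelic F.K (frameD V) × CMAdelic F.K (dW (cDiag Φ ι₁ (a : F.K) ha ha0).D) →* ℂˣ) (one_apply_rat_eq_one V (cDiag Φ ι₁ (a : F.K) ha ha0))
        (continuous_one_val V (cDiag Φ ι₁ (a : F.K) ha ha0)) _ hν hνc A hV hpos hemb D rfl rfl) fmodel hK hKo
  -- … and it IS the line theta pair (pointwise): ★ `apply_dist`, ★ H1's kernel identity (no `U(V)` scalar), `f_model`-vs-`w`, the frame point, `hĉ`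
  refine (congrArg (fun θ => θ ∈ CohFormsCarriers.holCotForms (CohFormsCarriers.archFactorOf F V)) ?_).mpr hmem
  funext x j
  rw [LinearMap.funLeft_apply]
  show _ = (LinearMap.proj j : Module.Dual ℂ (Fin 2 → ℂ)) (D.dist fmodel Φf (latticeEquiv F V hV x))
  rw [ThetaDistDatum.apply_dist]
  simp only [ThetaKernelDatum.thetaLiftFun_apply, ThetaDistDatum.fam_apply]
  -- the line instances in the `dW (cDiag …).D 0` spelling of ★ H1 (definitionally the ones above)
  letI mW' : MeasurableSpace (CMAdelic F.K (lineVec F.K (dW (cDiag Φ ι₁ (a : F.K) ha ha0).D 0)) ⧸ CMRat F.K (lineVec F.K (dW (cDiag Φ ι₁ (a : F.K) ha ha0).D 0))) := mW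
  haveI : BorelSpace (CMAdelic F.K (lineVec F.K (dW (cDiag Φ ι₁ (a : F.K) ha ha0).D 0)) ⧸ CMRat F.K (lineVec F.K (dW (cDiag Φ ι₁ (a : F.K) ha ha0).D 0))) := hBW
  haveI hcW' : CompactSpace (CMAdelic F.K (lineVec F.K (dW (cDiag Φ ι₁ (a : F.K) ha ha0).D 0)) ⧸ CMRat F.K (lineVec F.K (dW (cDiag Φ ι₁ (a : F.K) ha ha0).D 0))) := hcW
  haveI hnormal' : (CMRat F.K (lineVec F.K (dW (cDiag Φ ι₁ (a : F.K) ha ha0).D 0))).Normal := hnormal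
  -- cocompactness of the model quotient `[G_U]` (★ `ThetaAdelicSide.compactSpace_quot`, keyed on the lattice model) in ★ H1's spelling
  haveI hΓc : CompactSpace (↥(regimeSubgroup F V.Hm) ⧸ ((sideAt V Φ ι₁ (a : F.K) ha ha0 (1 : CMAdelic F.K (frameD V) × CMAdelic F.K (dW (cDiag Φ ι₁ (a : F.K) ha ha0).D) →* ℂˣ)
      (one_apply_rat_eq_one V (cDiag Φ ι₁ (a : F.K) ha ha0)) (continuous_one_val V (cDiag Φ ι₁ (a : F.K) ha ha0)) _ hν hνc A).P 0).ΓU) :=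
    ThetaAdelicSide.compactSpace_quot (S := sideAt V Φ ι₁ (a : F.K) ha ha0 (1 : CMAdelic F.K (frameD V) × CMAdelic F.K (dW (cDiag Φ ι₁ (a : F.K) ha ha0).D) →* ℂˣ) (one_apply_rat_eq_one V
        (cDiag Φ ι₁ (a : F.K) ha ha0)) (continuous_one_val V (cDiag Φ ι₁ (a : F.K) ha ha0)) _ hν hνc A) 0
  have h4id := @K2E2CapArchKernelIdentity.kernelDatum_thetaLift_eq_twist_splitting_thetaLift F ι₁ V (cDiag Φ ι₁ (a : F.K) ha ha0).D (compat_plane V Φ ι₁ (a : F.K) ha ha0)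
      (compat_line₀ V Φ ι₁ (a : F.K) ha ha0) (compat_line₁ V Φ ι₁ (a : F.K) ha ha0) (compat_line₂ V Φ ι₁ (a : F.K) ha ha0) (compat_line₃ V Φ ι₁ (a : F.K) ha ha0)
    _ _ _
    ((HodgeCM.Adelic.regimeEquiv F V.Hm hV).symm.trans (cmFrameEquiv F.K (frameG V) V.Hm (frameD V) (frame_congr V))).toMulEquiv
    (fun _ => rfl) (cmLineTorusEquiv F.K (a : F.K) ha0) (cmLineTorusEquiv_apply F.K (a : F.K) ha0) (cmLineTorusEquiv_mem_CMRat_iff F.K (a : F.K) ha0) hρ₀ Set.univ hSK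
    _ _ _ _ (probHaarRelNormOneQuot ↥(maximalRealSubfield F.K) F.K) _ ĉ ((sideAt V Φ ι₁ (a : F.K) ha ha0 (1 : CMAdelic F.K (frameD V) × CMAdelic F.K (dW (cDiag Φ ι₁
        (a : F.K) ha ha0).D) →* ℂˣ) (one_apply_rat_eq_one V (cDiag Φ ι₁ (a : F.K) ha ha0)) (continuous_one_val V (cDiag Φ ι₁ (a : F.K) ha ha0)) _ hν hνc A).P 0)
    (sideAt_P_ω V Φ ι₁ (a : F.K) ha ha0 (1 : CMAdelic F.K (frameD V) × CMAdelic F.K (dW (cDiag Φ ι₁ (a : F.K) ha ha0).D) →* ℂˣ) (one_apply_rat_eq_one V (cDiag Φ ι₁ (a : F.K) ha ha0))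
        (continuous_one_val V (cDiag Φ ι₁ (a : F.K) ha ha0)) _ hν hνc A 0) (ThetaAdelicSide.hΓU _ 0) hΓc hs' hρ' Set.univ (fun _ _ _ => Set.mem_univ _)
    (continuous_cmLineTorusEquiv F.K (a : F.K) ha0) (continuous_cmLineTorusEquiv_symm F.K (a : F.K) ha0) κ₁ hκ₁ κ₂ hκ₂
    (piSchwartzBruhatEquiv ↥(maximalRealSubfield F.K) (Fin 3) (D.Φarch (LinearMap.proj j) ⊗ₜ[ℂ] Φf)) f (latticeEquiv F V hV x)⁻¹
  refine (h4id.trans ?_).symm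
  have hpt : ((HodgeCM.Adelic.regimeEquiv F V.Hm hV).symm.trans (cmFrameEquiv F.K (frameG V) V.Hm (frameD V) (frame_congr V))).toMulEquiv (latticeEquiv F V hV x) =
      cmAdelicFrameTransport F.K 3 (HodgeCM.HermSpace3.Hm V) (frameD V) (frameG V) (frame_congr V) x := by
    apply Subtype.ext
    rw [coe_cmAdelicFrameTransport]
    show ((cmFrameEquiv F.K (frameG V) V.Hm (frameD V) (frame_congr V)
      ((HodgeCM.Adelic.regimeEquiv F V.Hm hV).symm (latticeEquiv F V hV x)) : CMAdelic F.K (frameD V)) :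
        GL (Fin 3) (AdeleRing (𝓞 F.K) F.K)) = _
    rw [coe_cmFrameEquiv]
    rfl
  rw [← hfw, map_inv, hpt]
  exact thetaLift_congr_splitting _ _ _ _ _ _ _ _ _ _ _ _ _ _ _ _ _ hĉ.symm _ _ _ _ _ _ _ _ _ _ _

end Summit.HodgeConjecture.HodgeConjecture.Cruxes.H413.K2E2CapArchPackagedLineLift

end
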